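import Summits.RiemannHypothesis.RiemannHypothesis.Theorems.GroundBartaEvenWinsBeyondArchDeflationCertBridgeWEven
import Summits.RiemannHypothesis.RiemannHypothesis.Theorems.GroundBartaEvenWinsBeyondArchDeflationWeightedRitzInner
import HarnessLib

/-!
# RiemannHypothesis / GroundBarta — rung 4 machinery (`EvenWinsBeyondArch`, stmt-RiemannHypothesis-18807 / 18085):
# the SLIVER estimate for penalties cut inside the window

Helper file (`--supports stmt-RiemannHypothesis-18085`), RH-free, no definitions, no named facts.  Prover A (g10 of
unit `sr-gb-rung-a`), endpoint cell `(log 5)/2`.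

At the endpoint the certificate's penalty polynomials `p_r` (scale `a₀ ≥ c`) are paired with tests `φ` supported in
the window `[-c, c]`, while the trial vectors are `v_r = 𝟙_{[-c',c']} p_r` with a rational cut `c' < c`.  The two
penalties differ by the sliver `c' < |x| ≤ c`:

* `dt_sliver_penalty_le` — `|⟨φ, 𝟙_{[-c,c]} p⟩|² ≤ 2|⟨φ, v⟩|² + 2·(2(b⁺ − c')B²)·∫ 𝟙_{|x|>c'}|φ|²` for `c ≤ b⁺` and
  `|p| ≤ B` on `c' < |x| ≤ b⁺` (Cauchy–Schwarz on the sliver);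
* `dt_sliver_penalty_le'` — the same when the certificate's polynomial `p̃` is a ROUNDING of `p` (`|p̃ − p| ≤ ε` on
  `[-c, c]`, the penalties of the endpoint certificate are the trial polynomials rescaled to `a₀` and rounded to
  `2⁻¹⁴⁰`): an extra global term `2·(2cε²)·∫|φ|²`.
-/

set_option linter.dupNamespace false

noncomputable section

open MeasureTheory Set Filter
open scoped Topology ComplexConjugate BigOperators

namespace Summit.RiemannHypothesis.RiemannHypothesis.Theorems.EvenWinsBeyondArch

open Literature.NumberTheory.LFunctions
open Summit.RiemannHypothesis.RiemannHypothesis.Theorems.OddSector (weilDirichletEnergy₂ weilPoleForm₂)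
open Summit.RiemannHypothesis.RiemannHypothesis.Theorems.GroundStateSimpleEven (incs_memLp)

/-- **The sliver estimate.**  For a smooth test `φ`, a continuous real `p`, `c' ≤ c ≤ b⁺`,
`|p| ≤ B` on `c' < |x| ≤ b⁺`, and `v = 𝟙_{[-c',c']} p`:
`|⟨φ, 𝟙_{[-c,c]} p⟩|² ≤ 2|⟨φ, v⟩|² + 2·(2(b⁺ − c')B²)·∫ 𝟙_{|x|>c'}|φ|²`. [folklore] -/
theorem dt_sliver_penalty_le {φ : ℝ → ℂ} (hφ : IsWeilTest φ) {c c' bp B : ℝ} (hcc : c' ≤ c)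
    (hcb : c ≤ bp) (p : ℝ → ℝ) (hp : Continuous p)
    (hB : ∀ x, c' < |x| → |x| ≤ bp → |p x| ≤ B) (hB0 : 0 ≤ B)
    (v : ℝ → ℂ) (hv : ∀ x, v x = (((Icc (-c') c').indicator p x : ℝ) : ℂ)) :
    ‖∫ x, φ x * conj ((((Icc (-c) c).indicator p x : ℝ) : ℂ))‖ ^ 2 ≤
      2 * ‖∫ x, φ x * conj (v x)‖ ^ 2 +
        2 * (2 * (bp - c') * B ^ 2) * ∫ x, {u : ℝ | c' < |u|}.indicator (fun u ↦ ‖φ u‖ ^ 2) x := by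
  have hS : MeasurableSet {u : ℝ | c' < |u|} := measurableSet_lt measurable_const continuous_abs.measurable
  set S : Set ℝ := {u : ℝ | c' < |u|} with hSdef
  -- the sliver part `e = 𝟙_{[-c,c]} p − v`
  set P : ℝ → ℂ := fun x ↦ (((Icc (-c) c).indicator p x : ℝ) : ℂ) with hPdef
  set e : ℝ → ℂ := fun x ↦ P x - v x with hedef
  have hveq : v = fun x ↦ (((Icc (-c') c').indicator p x : ℝ) : ℂ) := funext hv
  have hPm : Measurable P :=
    Complex.measurable_ofReal.comp ((hp.measurable).indicator measurableSet_Icc)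
  have hvm : Measurable v := dt_indicator_measurable hp hv
  have hem : Measurable e := hPm.sub hvm
  have hPL : MemLp P 2 volume := incs_memLp hp c
  have hvL : MemLp v 2 volume := by rw [hveq]; exact incs_memLp hp c'
  have heL : MemLp e 2 volume := hPL.sub hvL
  -- pointwise description of `e`
  have he_in : ∀ x, |x| ≤ c' → e x = 0 := by
    intro x hx
    have hx' : x ∈ Icc (-c') c' := abs_le.1 hx
    have hx'' : x ∈ Icc (-c) c := Icc_subset_Icc (by linarith) hcc hx'
    simp only [hedef, hPdef, hv x, indicator_of_mem hx', indicator_of_mem hx'', sub_self]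
  have he_out : ∀ x, c < |x| → e x = 0 := by
    intro x hx
    have hx' : x ∉ Icc (-c') c' := fun h ↦ by have := abs_le.2 h; linarith
    have hx'' : x ∉ Icc (-c) c := fun h ↦ by have := abs_le.2 h; linarith
    simp only [hedef, hPdef, hv x, indicator_of_notMem hx', indicator_of_notMem hx'']; simp
  have he_mid : ∀ x, c' < |x| → |x| ≤ c → e x = (p x : ℂ) := by
    intro x h1 h2
    have hx' : x ∉ Icc (-c') c' := fun h ↦ by have := abs_le.2 h; linarith
    have hx'' : x ∈ Icc (-c) c := abs_le.1 h2
    simp only [hedef, hPdef, hv x, indicator_of_notMem hx', indicator_of_mem hx'']; simp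
  have heB : ∀ x, ‖e x‖ ≤ B := by
    intro x
    by_cases h1 : c' < |x|
    · by_cases h2 : |x| ≤ c
      · rw [he_mid x h1 h2, Complex.norm_real, Real.norm_eq_abs]; exact hB x h1 (h2.trans hcb)
      · rw [he_out x (not_le.1 h2), norm_zero]; exact hB0
    · rw [he_in x (not_lt.1 h1), norm_zero]; exact hB0
  have he_zero_off : ∀ x, x ∉ S → e x = 0 := fun x hx ↦ he_in x (not_lt.1 hx)
  -- `‖e‖² ≤ B² (𝟙_{(c', b⁺]} + 𝟙_{[-b⁺, -c')})`
  have he_sq : ∀ x, ‖e x‖ ^ 2 ≤ B ^ 2 * ((Ioc c' bp).indicator 1 x + (Ico (-bp) (-c')).indicator 1 x) := by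
    intro x
    have hI1 : 0 ≤ (Ioc c' bp).indicator (1 : ℝ → ℝ) x := indicator_nonneg (fun _ _ ↦ zero_le_one) _
    have hI2 : 0 ≤ (Ico (-bp) (-c')).indicator (1 : ℝ → ℝ) x := indicator_nonneg (fun _ _ ↦ zero_le_one) _
    by_cases h1 : c' < |x|
    · by_cases h2 : |x| ≤ c
      · have hsq : ‖e x‖ ^ 2 ≤ B ^ 2 := by
          have := heB x
          nlinarith [norm_nonneg (e x)]
        have hone : 1 ≤ (Ioc c' bp).indicator (1 : ℝ → ℝ) x + (Ico (-bp) (-c')).indicator (1 : ℝ → ℝ) x := by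
          rcases lt_or_ge 0 x with hx0 | hx0
          · have hxa : |x| = x := abs_of_pos hx0
            have hmem : x ∈ Ioc c' bp := ⟨by rw [← hxa]; exact h1, by rw [← hxa]; exact h2.trans hcb⟩
            rw [indicator_of_mem hmem]; simp only [Pi.one_apply]; linarith
          · have hxa : |x| = -x := abs_of_nonpos hx0
            have hmem : x ∈ Ico (-bp) (-c') :=
              ⟨by have := h2.trans hcb; rw [hxa] at this; linarith, by rw [hxa] at h1; linarith⟩
            rw [indicator_of_mem hmem]; simp only [Pi.one_apply]; linarith
        calc ‖e x‖ ^ 2 ≤ B ^ 2 * 1 := by rw [mul_one]; exact hsq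
          _ ≤ B ^ 2 * ((Ioc c' bp).indicator 1 x + (Ico (-bp) (-c')).indicator 1 x) :=
              mul_le_mul_of_nonneg_left hone (sq_nonneg B)
      · rw [he_out x (not_le.1 h2), norm_zero]
        have : (0 : ℝ) ^ 2 = 0 := by norm_num
        rw [this]; positivity
    · rw [he_in x (not_lt.1 h1), norm_zero]
      have : (0 : ℝ) ^ 2 = 0 := by norm_num
      rw [this]; positivity
  have hvol1 : volume (Ioc c' bp) ≠ ⊤ := by rw [Real.volume_Ioc]; exact ENNReal.ofReal_ne_top
  have hvol2 : volume (Ico (-bp) (-c')) ≠ ⊤ := by rw [Real.volume_Ico]; exact ENNReal.ofReal_ne_top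
  have i1 : Integrable ((Ioc c' bp).indicator (1 : ℝ → ℝ)) :=
    (integrableOn_const hvol1).integrable_indicator measurableSet_Ioc
  have i2 : Integrable ((Ico (-bp) (-c')).indicator (1 : ℝ → ℝ)) :=
    (integrableOn_const hvol2).integrable_indicator measurableSet_Ico
  have he2i : Integrable fun x ↦ ‖e x‖ ^ 2 := (memLp_two_iff_integrable_sq_norm heL.1).1 heL
  have hint_e : ∫ x, ‖e x‖ ^ 2 ≤ 2 * (bp - c') * B ^ 2 := by
    have h1 : ∫ x, ‖e x‖ ^ 2 ≤ ∫ x, B ^ 2 * ((Ioc c' bp).indicator 1 x + (Ico (-bp) (-c')).indicator 1 x) :=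
      integral_mono he2i ((i1.add i2).const_mul _) he_sq
    have h2 : ∫ x, B ^ 2 * ((Ioc c' bp).indicator 1 x + (Ico (-bp) (-c')).indicator 1 x) =
        B ^ 2 * ((bp - c') + (bp - c')) := by
      rw [integral_const_mul, integral_add i1 i2, integral_indicator_one measurableSet_Ioc,
        integral_indicator_one measurableSet_Ico, Measure.real, Measure.real, Real.volume_Ioc, Real.volume_Ico,
        ENNReal.toReal_ofReal (by linarith), ENNReal.toReal_ofReal (by linarith)]
      ring
    rw [h2] at h1
    linarith
  -- the pairings
  have hφc : Continuous φ := hφ.1.continuous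
  have hφi : Integrable φ := hφc.integrable_of_hasCompactSupport hφ.2
  obtain ⟨G₀, hG₀⟩ := isCompact_Icc.exists_bound_of_continuousOn (hp.continuousOn : ContinuousOn p (Icc (-c) c))
  have hPb : ∀ x, ‖P x‖ ≤ max G₀ 0 := by
    intro x
    simp only [hPdef]
    rw [Complex.norm_real]
    by_cases hx : x ∈ Icc (-c) c
    · rw [indicator_of_mem hx]; exact (hG₀ x hx).trans (le_max_left _ _)
    · rw [indicator_of_notMem hx, norm_zero]; exact le_max_right _ _
  have hconj : ∀ f : ℝ → ℂ, Measurable f → (∀ x, ‖f x‖ ≤ max G₀ 0 + B) →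
      Integrable fun x ↦ φ x * conj (f x) := by
    intro f hf hfb
    refine hφi.mul_bdd (c := max G₀ 0 + B) (Complex.continuous_conj.measurable.comp hf).aestronglyMeasurable
      (Eventually.of_forall fun x ↦ ?_)
    show ‖conj (f x)‖ ≤ max G₀ 0 + B
    rw [Complex.norm_conj]; exact hfb x
  have hvb : ∀ x, ‖v x‖ ≤ max G₀ 0 + B := by
    intro x
    rw [hv x, Complex.norm_real]
    by_cases hx : x ∈ Icc (-c') c'
    · rw [indicator_of_mem hx]
      exact ((hG₀ x (Icc_subset_Icc (by linarith) hcc hx)).trans (le_max_left _ _)).trans (by linarith)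
    · rw [indicator_of_notMem hx, norm_zero]; exact add_nonneg (le_max_right _ _) hB0
  have iPv : Integrable fun x ↦ φ x * conj (v x) := hconj v hvm hvb
  have iPe : Integrable fun x ↦ φ x * conj (e x) := hconj e hem (fun x ↦ (heB x).trans (by
    linarith [le_max_right G₀ 0]))
  have hsplit : ∫ x, φ x * conj (P x) = (∫ x, φ x * conj (v x)) + ∫ x, φ x * conj (e x) := by
    rw [← integral_add iPv iPe]
    refine integral_congr_ae (Eventually.of_forall fun x ↦ ?_)
    simp only [hedef, map_sub]; ring
  -- Cauchy–Schwarz for the sliver pairing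
  have hI3 : ‖∫ x, φ x * conj (e x)‖ ^ 2 ≤ (∫ x, S.indicator (fun u ↦ ‖φ u‖ ^ 2) x) * (2 * (bp - c') * B ^ 2) := by
    set f : ℝ → ℂ := S.indicator φ with hfdef
    have hfL : MemLp f 2 volume := hφ.memLp_two.indicator hS
    have hpt : ∀ x, ‖φ x * conj (e x)‖ = ‖f x‖ * ‖e x‖ := by
      intro x
      rw [norm_mul, Complex.norm_conj]
      by_cases hx : x ∈ S
      · simp only [hfdef, indicator_of_mem hx]
      · rw [he_zero_off x hx, norm_zero, mul_zero, mul_zero]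
    have h1 : ‖∫ x, φ x * conj (e x)‖ ≤ ∫ x, ‖f x‖ * ‖e x‖ := by
      calc ‖∫ x, φ x * conj (e x)‖ ≤ ∫ x, ‖φ x * conj (e x)‖ := norm_integral_le_integral_norm _
        _ = ∫ x, ‖f x‖ * ‖e x‖ := integral_congr_ae (Eventually.of_forall hpt)
    have hfL' : MemLp f (ENNReal.ofReal 2) volume := by rwa [ENNReal.ofReal_ofNat]
    have heL' : MemLp e (ENNReal.ofReal 2) volume := by rwa [ENNReal.ofReal_ofNat]
    have h2 := integral_mul_norm_le_Lp_mul_Lq Real.HolderConjugate.two_two hfL' heL'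
    have ef : ∫ x, ‖f x‖ ^ (2 : ℝ) = ∫ x, S.indicator (fun u ↦ ‖φ u‖ ^ 2) x := by
      refine integral_congr_ae (Eventually.of_forall fun x ↦ ?_)
      simp only [Real.rpow_two, hfdef]
      by_cases hx : x ∈ S
      · simp only [indicator_of_mem hx]
      · simp only [indicator_of_notMem hx, norm_zero]; norm_num
    have ee : ∫ x, ‖e x‖ ^ (2 : ℝ) = ∫ x, ‖e x‖ ^ 2 := by
      refine integral_congr_ae (Eventually.of_forall fun x ↦ ?_); simp only [Real.rpow_two]
    rw [ef, ee, ← Real.sqrt_eq_rpow, ← Real.sqrt_eq_rpow] at h2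
    have hX0 : 0 ≤ ∫ x, S.indicator (fun u ↦ ‖φ u‖ ^ 2) x :=
      integral_nonneg fun x ↦ indicator_nonneg (fun _ _ ↦ by positivity) _
    have hY0 : 0 ≤ ∫ x, ‖e x‖ ^ 2 := integral_nonneg fun x ↦ by positivity
    have h3 : ‖∫ x, φ x * conj (e x)‖ ≤
        Real.sqrt (∫ x, S.indicator (fun u ↦ ‖φ u‖ ^ 2) x) * Real.sqrt (∫ x, ‖e x‖ ^ 2) := h1.trans h2
    have h4 : ‖∫ x, φ x * conj (e x)‖ ^ 2 ≤ (∫ x, S.indicator (fun u ↦ ‖φ u‖ ^ 2) x) * ∫ x, ‖e x‖ ^ 2 := by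
      have h0 := norm_nonneg (∫ x, φ x * conj (e x))
      calc ‖∫ x, φ x * conj (e x)‖ ^ 2
          ≤ (Real.sqrt (∫ x, S.indicator (fun u ↦ ‖φ u‖ ^ 2) x) * Real.sqrt (∫ x, ‖e x‖ ^ 2)) ^ 2 :=
            pow_le_pow_left₀ h0 h3 2
        _ = (∫ x, S.indicator (fun u ↦ ‖φ u‖ ^ 2) x) * ∫ x, ‖e x‖ ^ 2 := by
            rw [mul_pow, Real.sq_sqrt hX0, Real.sq_sqrt hY0]
    exact h4.trans (mul_le_mul_of_nonneg_left hint_e hX0)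
  -- assemble
  have hmain : ∀ a b : ℂ, ‖a + b‖ ^ 2 ≤ 2 * ‖a‖ ^ 2 + 2 * ‖b‖ ^ 2 := fun a b ↦ by
    have h := norm_add_le a b
    have h0 := norm_nonneg (a + b)
    nlinarith [sq_nonneg (‖a‖ - ‖b‖), norm_nonneg a, norm_nonneg b]
  have hmain := hmain (∫ x, φ x * conj (v x)) (∫ x, φ x * conj (e x))
  rw [← hsplit] at hmain
  have hX0 : 0 ≤ ∫ x, S.indicator (fun u ↦ ‖φ u‖ ^ 2) x :=
    integral_nonneg fun x ↦ indicator_nonneg (fun _ _ ↦ by positivity) _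
  calc ‖∫ x, φ x * conj (P x)‖ ^ 2
      ≤ 2 * ‖∫ x, φ x * conj (v x)‖ ^ 2 + 2 * ‖∫ x, φ x * conj (e x)‖ ^ 2 := hmain
    _ ≤ 2 * ‖∫ x, φ x * conj (v x)‖ ^ 2 +
          2 * (2 * (bp - c') * B ^ 2) * ∫ x, S.indicator (fun u ↦ ‖φ u‖ ^ 2) x := by nlinarith [hI3]

/-- **The sliver estimate with a rounded certificate polynomial.**  As `dt_sliver_penalty_le`, but the certificate's
polynomial `p̃` only APPROXIMATES the trial polynomial `p` on the window: `|p̃ − p| ≤ ε` on `[-c, c]` (`0 ≤ c`).  Then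
`|⟨φ, 𝟙_{[-c,c]} p̃⟩|² ≤ 4|⟨φ, v⟩|² + 4·(2(b⁺ − c')B²)·∫ 𝟙_{|x|>c'}|φ|² + 2·(2cε²)·∫|φ|²`. [folklore] -/
theorem dt_sliver_penalty_le' {φ : ℝ → ℂ} (hφ : IsWeilTest φ) {c c' bp B ε : ℝ} (hc : 0 ≤ c) (hcc : c' ≤ c)
    (hcb : c ≤ bp) (p pt : ℝ → ℝ) (hp : Continuous p) (hpt : Continuous pt)
    (hB : ∀ x, c' < |x| → |x| ≤ bp → |p x| ≤ B) (hB0 : 0 ≤ B)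
    (hε : ∀ x ∈ Icc (-c) c, |pt x - p x| ≤ ε) (hε0 : 0 ≤ ε)
    (v : ℝ → ℂ) (hv : ∀ x, v x = (((Icc (-c') c').indicator p x : ℝ) : ℂ)) :
    ‖∫ x, φ x * conj ((((Icc (-c) c).indicator pt x : ℝ) : ℂ))‖ ^ 2 ≤
      4 * ‖∫ x, φ x * conj (v x)‖ ^ 2 +
        4 * (2 * (bp - c') * B ^ 2) * (∫ x, {u : ℝ | c' < |u|}.indicator (fun u ↦ ‖φ u‖ ^ 2) x) +
        2 * (2 * c * ε ^ 2) * ∫ x, ‖φ x‖ ^ 2 := by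
  have hold := dt_sliver_penalty_le hφ hcc hcb p hp hB hB0 v hv
  -- the rounding part `e₁ = 𝟙_{[-c,c]} (p̃ − p)`
  set P : ℝ → ℂ := fun x ↦ (((Icc (-c) c).indicator p x : ℝ) : ℂ) with hPdef
  set Pt : ℝ → ℂ := fun x ↦ (((Icc (-c) c).indicator pt x : ℝ) : ℂ) with hPtdef
  set e₁ : ℝ → ℂ := fun x ↦ Pt x - P x with he₁
  have hPm : Measurable P := Complex.measurable_ofReal.comp ((hp.measurable).indicator measurableSet_Icc)
  have hPtm : Measurable Pt := Complex.measurable_ofReal.comp ((hpt.measurable).indicator measurableSet_Icc)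
  have he₁m : Measurable e₁ := hPtm.sub hPm
  have he₁L : MemLp e₁ 2 volume := (incs_memLp hpt c).sub (incs_memLp hp c)
  have he₁b : ∀ x, ‖e₁ x‖ ≤ (Icc (-c) c).indicator (fun _ ↦ ε) x := by
    intro x
    by_cases hx : x ∈ Icc (-c) c
    · simp only [he₁, hPdef, hPtdef, indicator_of_mem hx]
      rw [← Complex.ofReal_sub, Complex.norm_real, Real.norm_eq_abs]; exact hε x hx
    · simp only [he₁, hPdef, hPtdef, indicator_of_notMem hx, sub_self, norm_zero]; exact le_rfl
  have he₁b' : ∀ x, ‖e₁ x‖ ≤ ε := fun x ↦ (he₁b x).trans (indicator_le_self' (fun _ _ ↦ hε0) x) |>.trans le_rfl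
  -- `∫ ‖e₁‖² ≤ 2cε²`
  have hvol : volume (Icc (-c) c) ≠ ⊤ := by rw [Real.volume_Icc]; exact ENNReal.ofReal_ne_top
  have iI : Integrable ((Icc (-c) c).indicator fun _ : ℝ ↦ ε ^ 2) :=
    (integrableOn_const hvol).integrable_indicator measurableSet_Icc
  have he₁2i : Integrable fun x ↦ ‖e₁ x‖ ^ 2 := (memLp_two_iff_integrable_sq_norm he₁L.1).1 he₁L
  have hint_e₁ : ∫ x, ‖e₁ x‖ ^ 2 ≤ 2 * c * ε ^ 2 := by
    have h1 : ∫ x, ‖e₁ x‖ ^ 2 ≤ ∫ x, (Icc (-c) c).indicator (fun _ : ℝ ↦ ε ^ 2) x := by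
      refine integral_mono he₁2i iI fun x ↦ ?_
      by_cases hx : x ∈ Icc (-c) c
      · rw [indicator_of_mem hx]
        have := he₁b x; rw [indicator_of_mem hx] at this
        nlinarith [norm_nonneg (e₁ x)]
      · have := he₁b x; rw [indicator_of_notMem hx] at this
        have h0 : ‖e₁ x‖ = 0 := le_antisymm this (norm_nonneg _)
        rw [indicator_of_notMem hx, h0]; norm_num
    have h2 : ∫ x, (Icc (-c) c).indicator (fun _ : ℝ ↦ ε ^ 2) x = 2 * c * ε ^ 2 := by
      rw [integral_indicator_const _ measurableSet_Icc, Measure.real, Real.volume_Icc,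
        ENNReal.toReal_ofReal (by linarith), smul_eq_mul]; ring
    rw [h2] at h1; exact h1
  -- integrability of the pairings
  have hφc : Continuous φ := hφ.1.continuous
  have hφi : Integrable φ := hφc.integrable_of_hasCompactSupport hφ.2
  obtain ⟨G₀, hG₀⟩ := isCompact_Icc.exists_bound_of_continuousOn (hp.continuousOn : ContinuousOn p (Icc (-c) c))
  have hconj : ∀ f : ℝ → ℂ, Measurable f → ∀ C : ℝ, (∀ x, ‖f x‖ ≤ C) → Integrable fun x ↦ φ x * conj (f x) := by
    intro f hf C hfb
    refine hφi.mul_bdd (c := C) (Complex.continuous_conj.measurable.comp hf).aestronglyMeasurable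
      (Eventually.of_forall fun x ↦ ?_)
    show ‖conj (f x)‖ ≤ C
    rw [Complex.norm_conj]; exact hfb x
  have hPb : ∀ x, ‖P x‖ ≤ max G₀ 0 := by
    intro x
    simp only [hPdef]
    rw [Complex.norm_real]
    by_cases hx : x ∈ Icc (-c) c
    · rw [indicator_of_mem hx]; exact (hG₀ x hx).trans (le_max_left _ _)
    · rw [indicator_of_notMem hx, norm_zero]; exact le_max_right _ _
  have iP : Integrable fun x ↦ φ x * conj (P x) := hconj P hPm _ hPb
  have ie₁ : Integrable fun x ↦ φ x * conj (e₁ x) := hconj e₁ he₁m ε he₁b'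
  have hsplit : ∫ x, φ x * conj (Pt x) = (∫ x, φ x * conj (P x)) + ∫ x, φ x * conj (e₁ x) := by
    rw [← integral_add iP ie₁]
    refine integral_congr_ae (Eventually.of_forall fun x ↦ ?_)
    simp only [he₁, map_sub]; ring
  -- Cauchy–Schwarz for the rounding pairing
  have hI : ‖∫ x, φ x * conj (e₁ x)‖ ^ 2 ≤ (∫ x, ‖φ x‖ ^ 2) * (2 * c * ε ^ 2) := by
    have h1 : ‖∫ x, φ x * conj (e₁ x)‖ ≤ ∫ x, ‖φ x‖ * ‖e₁ x‖ := by
      calc ‖∫ x, φ x * conj (e₁ x)‖ ≤ ∫ x, ‖φ x * conj (e₁ x)‖ := norm_integral_le_integral_norm _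
        _ = ∫ x, ‖φ x‖ * ‖e₁ x‖ := integral_congr_ae (Eventually.of_forall fun x ↦ by
            show ‖φ x * conj (e₁ x)‖ = ‖φ x‖ * ‖e₁ x‖
            rw [norm_mul, Complex.norm_conj])
    have hφL' : MemLp φ (ENNReal.ofReal 2) volume := by rw [ENNReal.ofReal_ofNat]; exact hφ.memLp_two
    have he₁L' : MemLp e₁ (ENNReal.ofReal 2) volume := by rwa [ENNReal.ofReal_ofNat]
    have h2 := integral_mul_norm_le_Lp_mul_Lq Real.HolderConjugate.two_two hφL' he₁L'
    have ef : ∫ x, ‖φ x‖ ^ (2 : ℝ) = ∫ x, ‖φ x‖ ^ 2 :=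
      integral_congr_ae (Eventually.of_forall fun x ↦ by simp only [Real.rpow_two])
    have ee : ∫ x, ‖e₁ x‖ ^ (2 : ℝ) = ∫ x, ‖e₁ x‖ ^ 2 :=
      integral_congr_ae (Eventually.of_forall fun x ↦ by simp only [Real.rpow_two])
    rw [ef, ee, ← Real.sqrt_eq_rpow, ← Real.sqrt_eq_rpow] at h2
    have hX0 : 0 ≤ ∫ x, ‖φ x‖ ^ 2 := integral_nonneg fun x ↦ by positivity
    have hY0 : 0 ≤ ∫ x, ‖e₁ x‖ ^ 2 := integral_nonneg fun x ↦ by positivity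
    have h3 := h1.trans h2
    have h4 : ‖∫ x, φ x * conj (e₁ x)‖ ^ 2 ≤ (∫ x, ‖φ x‖ ^ 2) * ∫ x, ‖e₁ x‖ ^ 2 := by
      have h0 := norm_nonneg (∫ x, φ x * conj (e₁ x))
      calc ‖∫ x, φ x * conj (e₁ x)‖ ^ 2
          ≤ (Real.sqrt (∫ x, ‖φ x‖ ^ 2) * Real.sqrt (∫ x, ‖e₁ x‖ ^ 2)) ^ 2 := pow_le_pow_left₀ h0 h3 2
        _ = (∫ x, ‖φ x‖ ^ 2) * ∫ x, ‖e₁ x‖ ^ 2 := by rw [mul_pow, Real.sq_sqrt hX0, Real.sq_sqrt hY0]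
    exact h4.trans (mul_le_mul_of_nonneg_left hint_e₁ hX0)
  -- assemble
  have hsq : ∀ a b : ℂ, ‖a + b‖ ^ 2 ≤ 2 * ‖a‖ ^ 2 + 2 * ‖b‖ ^ 2 := fun a b ↦ by
    have h := norm_add_le a b
    have h0 := norm_nonneg (a + b)
    nlinarith [sq_nonneg (‖a‖ - ‖b‖), norm_nonneg a, norm_nonneg b]
  have hmain := hsq (∫ x, φ x * conj (P x)) (∫ x, φ x * conj (e₁ x))
  rw [← hsplit] at hmain
  have hX0 : 0 ≤ ∫ x, ‖φ x‖ ^ 2 := integral_nonneg fun x ↦ by positivity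
  have hY0 : 0 ≤ ∫ x, {u : ℝ | c' < |u|}.indicator (fun u ↦ ‖φ u‖ ^ 2) x :=
    integral_nonneg fun x ↦ indicator_nonneg (fun _ _ ↦ by positivity) _
  have hK0 : 0 ≤ 2 * (bp - c') * B ^ 2 := by have : 0 ≤ bp - c' := (by linarith); positivity
  nlinarith [hold, hI, hmain]

end Summit.RiemannHypothesis.RiemannHypothesis.Theorems.EvenWinsBeyondArch

end
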